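import Summits.CriticalPhenomena.PercolationContinuityZ3.Theorems.PercNearOneGluingNoHeavyLowerTailStarSetPoolAccounting
import Summits.CriticalPhenomena.PercolationContinuityZ3.Theorems.PercNearOneGluingNoHeavyLowerTailStarSetAggregation
import Summits.CriticalPhenomena.PercolationContinuityZ3.Theorems.PercNearOneGluingNoHeavyLowerTailStarSetClassBalanced
import HarnessLib

/-!
# `NoHeavyLowerTail` (stmt-CriticalPhenomena-4575) — tools for the pool of the U1′_r charging scheme (U1-PROOF.md §7; blueprint §F6/§G4)

Support file (prover `prim-gen-swap` gen 15; `--supports stmt-CriticalPhenomena-4575`).  No definitions, no named facts, no sorries.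

Small lemmas used by the pool accounting (`StarSet.pool_bound`): cylinder weights in pool units (`E₀ = Π_{V ∉ Pool}(1 − θ_V)`,
odds `t_V = θ_V/(1 − θ_V)`), the load of one claimant class with a closed constraint, the odds product `P = Π(1 + t)` and its
sub-products, and the symmetrisation of a sum over ordered pairs.

* `StarSet.cylinder_pool_eq` — `Π_{A} θ · Π_{V ∉ Pool ∪ A}(1 − θ) = E₀ · Π_{A} t` for `A` disjoint from `Pool`;
* `StarSet.key_class_load_le_closed` — distinct configurations containing `O` and avoiding `Cl` weigh at most `Π_O θ · Π_{Cl}(1 − θ)`;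
* `StarSet.units_load_le_cylinder_pool` — the same in pool units: `≤ E₀ · Π_{O} t` when the configurations lie inside `Pool ∪ O`;
* `StarSet.one_add_sum_le_odds_prod`, `StarSet.subprod_le_odds_prod` — lower bounds for `P = Π_{V ∉ Pool}(1 + t_V)`;
* `StarSet.sum_offDiag_symm` — `Σ_X Σ_{Y ≠ X} f X Y = 2 Σ_X Σ_{Y > X} f X Y` for symmetric `f`.
-/

namespace Summit.CriticalPhenomena.PercolationContinuityZ3.Theorems

open Finset
open scoped BigOperators

namespace StarSet

variable {ι : Type*} [Fintype ι]

/-- **Cylinder weights in pool units**: `Π_{A} θ · Π_{V ∉ Pool ∪ A}(1 − θ_V) = E₀ · Π_{A} θ_V/(1 − θ_V)` for `A ∩ Pool = ∅`, all `θ < 1`. -/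
theorem cylinder_pool_eq [DecidableEq ι] (θ : ι → ℝ) (hθ1 : ∀ k, θ k < 1) (Pool A : Finset ι) (hA : Disjoint A Pool) :
    (∏ k ∈ A, θ k) * ∏ k ∈ univ \ (Pool ∪ A), (1 - θ k) =
      (∏ k ∈ univ \ Pool, (1 - θ k)) * ∏ k ∈ A, θ k / (1 - θ k) := by
  have hsplit : univ \ Pool = (univ \ (Pool ∪ A)) ∪ A := by
    ext k
    simp only [mem_sdiff, mem_univ, true_and, mem_union, not_or]
    constructor
    · intro hk
      by_cases hkA : k ∈ A
      · exact Or.inr hkA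
      · exact Or.inl ⟨hk, hkA⟩
    · rintro (⟨hk, -⟩ | hk)
      · exact hk
      · exact disjoint_left.1 hA hk
  have hdisj : Disjoint (univ \ (Pool ∪ A)) A := by
    rw [disjoint_right]
    intro k hk hk'
    exact (mem_sdiff.1 hk').2 (mem_union_right _ hk)
  rw [hsplit, prod_union hdisj, mul_assoc, ← prod_mul_distrib, mul_comm]
  congr 1
  refine prod_congr rfl fun k _ => ?_
  have h : 1 - θ k ≠ 0 := by linarith [hθ1 k]
  field_simp

/-- **One claimant class with a closed constraint** (L2.2): units with pairwise distinct configurations all containing `O` and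
avoiding `Cl` (`O, Cl` disjoint) have total weight `≤ Π_{O} θ · Π_{Cl}(1 − θ)`. -/
theorem key_class_load_le_closed [DecidableEq ι] (θ : ι → ℝ) (hθ0 : ∀ i, 0 ≤ θ i) (hθ1 : ∀ i, θ i ≤ 1)
    (Uk : Finset (Finset ι × ι)) (O Cl : Finset ι) (hOC : Disjoint O Cl)
    (hcyl : ∀ u ∈ Uk, O ⊆ u.1 ∧ ∀ k ∈ Cl, k ∉ u.1) (hinj : ∀ u ∈ Uk, ∀ v ∈ Uk, u.1 = v.1 → u = v) :
    ∑ u ∈ Uk, ((∏ k ∈ u.1, θ k) * ∏ k ∈ univ \ u.1, (1 - θ k)) ≤ (∏ k ∈ O, θ k) * ∏ k ∈ Cl, (1 - θ k) := by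
  classical
  have hinj' : Set.InjOn (fun u : Finset ι × ι => u.1) ↑Uk := fun u hu v hv h => hinj u hu v hv h
  rw [← sum_image (f := fun S : Finset ι => (∏ k ∈ S, θ k) * ∏ k ∈ univ \ S, (1 - θ k)) hinj']
  set C := Uk.image (fun u : Finset ι × ι => u.1) with hC
  have h := weighted_sum_le_cylinder θ hθ0 hθ1 O Cl hOC (fun S => if S ∈ C then (1 : ℝ) else 0)
    (fun S => by by_cases h : S ∈ C <;> simp [h]) (fun S hS => by
      by_cases h : S ∈ C
      · obtain ⟨u, hu, rfl⟩ := mem_image.1 h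
        exact hcyl u hu
      · simp [h] at hS)
  have hsub : C ⊆ (univ : Finset ι).powerset := fun S _ => mem_powerset.2 (subset_univ S)
  simp_rw [mul_boole] at h
  rw [sum_ite_mem, inter_eq_right.2 hsub] at h
  exact h

/-- **Load of a claimant class in pool units**: units with hub-independent distinct configurations (`u.1` determines `u`) all containing
`O` (disjoint from `Pool`) and contained in `Pool ∪ O` weigh at most `E₀ · Π_{O} t`. -/
theorem units_load_le_cylinder_pool [DecidableEq ι] (θ : ι → ℝ) (hθ0 : ∀ i, 0 ≤ θ i) (hθ1 : ∀ k, θ k < 1)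
    (Pool O : Finset ι) (hO : Disjoint O Pool) (Uk : Finset (Finset ι × ι))
    (hcyl : ∀ u ∈ Uk, O ⊆ u.1 ∧ ∀ k ∈ u.1, k ∉ O → k ∈ Pool) (hinj : ∀ u ∈ Uk, ∀ v ∈ Uk, u.1 = v.1 → u = v) :
    ∑ u ∈ Uk, ((∏ k ∈ u.1, θ k) * ∏ k ∈ univ \ u.1, (1 - θ k)) ≤
      (∏ k ∈ univ \ Pool, (1 - θ k)) * ∏ k ∈ O, θ k / (1 - θ k) := by
  rw [← cylinder_pool_eq θ hθ1 Pool O hO]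
  refine key_class_load_le_closed θ hθ0 (fun i => (hθ1 i).le) Uk O (univ \ (Pool ∪ O)) ?_ (fun u hu => ⟨(hcyl u hu).1, ?_⟩) hinj
  · rw [disjoint_right]
    intro k hk hk'
    exact (mem_sdiff.1 hk).2 (mem_union_right _ hk')
  · intro k hk hkS
    have hk' := mem_sdiff.1 hk
    rw [mem_union, not_or] at hk'
    exact hk'.2.1 ((hcyl u hu).2 k hkS hk'.2.2)

/-- **`1 + Σ_{A} t ≤ P`** for `A ⊆ univ ∖ Pool`: the odds product `P = Π_{V ∉ Pool}(1 + t_V)` dominates one plus any sub-sum. -/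
theorem one_add_sum_le_odds_prod [DecidableEq ι] (t : ι → ℝ) (ht0 : ∀ k, 0 ≤ t k) (Pool A : Finset ι) (hA : Disjoint A Pool) :
    1 + ∑ k ∈ A, t k ≤ ∏ k ∈ univ \ Pool, (1 + t k) := by
  have hsub : A ⊆ univ \ Pool := fun k hk => mem_sdiff.2 ⟨mem_univ _, disjoint_left.1 hA hk⟩
  refine (one_add_sum_le_prod_one_add' A t fun i _ => ht0 i).trans ?_
  exact prod_le_prod_of_subset_of_one_le hsub (fun k _ => by linarith [ht0 k]) fun k _ _ => by linarith [ht0 k]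

/-- **`Π_{A} (1 + t) ≤ P`** for `A ⊆ univ ∖ Pool`. -/
theorem subprod_le_odds_prod [DecidableEq ι] (t : ι → ℝ) (ht0 : ∀ k, 0 ≤ t k) (Pool A : Finset ι) (hA : Disjoint A Pool) :
    ∏ k ∈ A, (1 + t k) ≤ ∏ k ∈ univ \ Pool, (1 + t k) := by
  have hsub : A ⊆ univ \ Pool := fun k hk => mem_sdiff.2 ⟨mem_univ _, disjoint_left.1 hA hk⟩
  exact prod_le_prod_of_subset_of_one_le hsub (fun k _ => by linarith [ht0 k]) fun k _ _ => by linarith [ht0 k]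

omit [Fintype ι] in
/-- **Symmetrisation**: `Σ_{X ∈ H} Σ_{Y ∈ H, Y ≠ X} f X Y = 2 · Σ_{X ∈ H} Σ_{Y ∈ H, X < Y} f X Y` for `f` symmetric on `H`. -/
theorem sum_offDiag_symm [LinearOrder ι] (H : Finset ι) (f : ι → ι → ℝ) (hf : ∀ X ∈ H, ∀ Y ∈ H, f X Y = f Y X) :
    ∑ X ∈ H, ∑ Y ∈ H with Y ≠ X, f X Y = 2 * ∑ X ∈ H, ∑ Y ∈ H with X < Y, f X Y := by
  classical
  have hsplit : ∀ X ∈ H, ∑ Y ∈ H with Y ≠ X, f X Y = ∑ Y ∈ H with X < Y, f X Y + ∑ Y ∈ H with Y < X, f X Y := by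
    intro X _
    rw [← sum_filter_add_sum_filter_not (H.filter (fun Y => Y ≠ X)) (fun Y => X < Y)]
    congr 1
    · rw [filter_filter]
      exact sum_congr (filter_congr fun Y _ => ⟨fun h => h.2, fun h => ⟨ne_of_gt h, h⟩⟩) fun _ _ => rfl
    · rw [filter_filter]
      refine sum_congr (filter_congr fun Y _ => ?_) fun _ _ => rfl
      constructor
      · rintro ⟨h1, h2⟩; exact lt_of_le_of_ne (not_lt.1 h2) h1
      · intro h; exact ⟨ne_of_lt h, not_lt.2 h.le⟩
  rw [sum_congr rfl hsplit, sum_add_distrib]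
  have hswap : ∑ X ∈ H, ∑ Y ∈ H with Y < X, f X Y = ∑ X ∈ H, ∑ Y ∈ H with X < Y, f X Y := by
    rw [show (∑ X ∈ H, ∑ Y ∈ H with Y < X, f X Y) = ∑ X ∈ H, ∑ Y ∈ H, (if Y < X then f X Y else 0) from
      sum_congr rfl fun X _ => sum_filter _ _, sum_comm]
    refine sum_congr rfl fun Y hY => ?_
    rw [sum_filter]
    exact sum_congr rfl fun X hX => by
      by_cases h : Y < X
      · rw [if_pos h, if_pos h, hf X hX Y hY]
      · rw [if_neg h, if_neg h]
  rw [hswap]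
  ring

end StarSet

end Summit.CriticalPhenomena.PercolationContinuityZ3.Theorems
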